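import Summits.CriticalPhenomena.PercolationContinuityZ3.Theorems.PercNearOneGluingNoHeavyLowerTailTwoPartitionJuntaLiftFin
import Mathlib.Logic.Equiv.Fin.Basic
import Mathlib.Data.Fintype.BigOperators
import Mathlib.Tactic.Ring
import Mathlib.Tactic.Linarith
import HarnessLib.Audit

/-!
# `NoHeavyLowerTail` (crux stmt-CriticalPhenomena-4575), master-family hierarchy P3 (gen 30): the ONE-COORDINATE SPLIT of the
# three-set antipodal functional — an exact inequality `N(𝒜₀) + N(𝒜₁) ≤ N(𝒜) + D` whose only defect `D` counts the complementary
# pairs of the JUMP SET `𝒜₁ ∖ 𝒜₀`; hence `ThreeSetAntipodal` for every SYMMETRIC THRESHOLD up-set `{S : t ≤ #S}` (all `n, t`,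
# arbitrary up-sets `ℬ, 𝒞`)

Support file (seat `prim-masterthm-p3`; `--supports stmt-CriticalPhenomena-4575`; memo
`run/shared/lean/prim/prim-masterthm/FROM-prim-masterthm-p3-g30-SPLIT-AND-THRESHOLDS.md`, HIERARCHY §37).  Companion of
`…TwoPartitionThreeSet` (`threeSetN`, the `@[conjecture] ThreeSetAntipodal`, its faces), `…TwoPartitionJuntaLift` (`chi`, `fib`,
`threeSetN_eq_sum`) and `…TwoPartitionFibre` (`famMap`, `threeSetN_famMap`).

THE SPLIT (this work).  Ground set `ι ⊕ Unit`; write `𝒳₀ = fib 𝒳 ∅`, `𝒳₁ = fib 𝒳 univ` for the two layers of a family `𝒳` (so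
`𝒳₀ ⊆ 𝒳₁` pointwise for an up-set) and `J = 𝒜₁ ∖ 𝒜₀` for the JUMP SET of `𝒜` across the distinguished coordinate.  For up-sets
`𝒜, ℬ, 𝒞` of `2^(ι ⊕ Unit)`:

  `threeSetN 𝒜₀ ℬ₀ 𝒞₀ + threeSetN 𝒜₁ ℬ₁ 𝒞₁ ≤ threeSetN 𝒜 ℬ 𝒞 + #(J ∩ Jᶜˢ ∩ ℬ₀ ∩ 𝒞₀)`      (`threeSetN_fib_add_fib_le`).

Proof: both sides are sums over `e ⊆ ι` of polynomials in the twelve indicators `χ_{𝒳_j}(e), χ_{𝒳_j}(eᶜ)`; after moving one group of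
terms along the bijection `e ↦ eᶜ` the difference is, point by point,
`(a₁' − a₀')(1 − a₁)(b₁c₁ − b₀c₀) + [a₀a₀'b₀c₀' + a₁a₁'b₁c₁' − a₀a₁'b₀c₁' − a₁a₀'b₁c₀'] ≥ 0` (`a_j = χ_{𝒜_j}(e)`, primes at `eᶜ`),
a sum of products of nonnegative differences (`split_pointwise_nonneg`).  So the naive induction on the dimension fails EXACTLY by
the complementary pairs `{e, eᶜ} ⊆ J` with `e ∈ ℬ₀ ∩ 𝒞₀` (this is the signed remainder `Δ` of gens 25–26, now with its sign isolated):
**`threeSetN_nonneg_of_fib`** — if the jump set is complement-free (`J ∩ Jᶜˢ = ∅`) then `ThreeSetAntipodal` for the two layer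
triples implies it for `(𝒜, ℬ, 𝒞)`.

CONSEQUENCE (this work, unconditional): **`threeSetN_threshold_nonneg`** — for every `n, t` and all up-sets `ℬ, 𝒞 ⊆ 2^[n]`,
`0 ≤ threeSetN {S : t ≤ #S} ℬ 𝒞`.  (Induction on `n`: if `n < 2t` the threshold family is complement-free — the known face
`threeSetN_nonneg_of_inter_compls_eq_empty`; otherwise split off the last coordinate: the layers are the thresholds `t` and `t − 1` on
`n − 1` points and the jump set `{#e = t − 1}` meets its complement family `{#e = n − t}` only if `n = 2t − 1 < 2t`.)  Previously the
symmetric thresholds were covered only for `n ≤ 6` (junta lift + exhaustive census, evidence) or with `ℬ, 𝒞` thresholds too (numerics).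
HONEST LABEL: an exact one-coordinate inequality, its complement-free-jump corollary, and one infinite family of the conjecture;
`ThreeSetAntipodal` itself (hence `SQKD`, `WeightedBase`, `KeySandwich`) stays OPEN. [this work]
-/

namespace Summit.CriticalPhenomena.PercolationContinuityZ3.Theorems.TwoPartition

open Finset
open scoped FinsetFamily

/-! ### Indicator facts -/

section chi
variable {τ : Type*} [DecidableEq τ] [Fintype τ]

omit [Fintype τ] in
/-- `χ` takes the values `0` and `1`. [this work] -/
theorem chi_zero_or_one (𝒳 : Finset (Finset τ)) (S : Finset τ) : chi 𝒳 S = 0 ∨ chi 𝒳 S = 1 := by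
  unfold chi; split_ifs <;> simp

omit [Fintype τ] in
/-- `0 ≤ χ`. [this work] -/
theorem chi_nonneg (𝒳 : Finset (Finset τ)) (S : Finset τ) : 0 ≤ chi 𝒳 S := by
  rcases chi_zero_or_one 𝒳 S with h | h <;> omega

omit [Fintype τ] in
/-- `χ ≤ 1`. [this work] -/
theorem chi_le_one (𝒳 : Finset (Finset τ)) (S : Finset τ) : chi 𝒳 S ≤ 1 := by
  rcases chi_zero_or_one 𝒳 S with h | h <;> omega

omit [Fintype τ] in
/-- `χ` of a set difference. [this work] -/
theorem chi_sdiff (𝒳 𝒴 : Finset (Finset τ)) (S : Finset τ) : chi (𝒳 \ 𝒴) S = chi 𝒳 S * (1 - chi 𝒴 S) := by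
  unfold chi
  simp only [mem_sdiff]
  split_ifs <;> simp_all

end chi

/-! ### The pointwise inequality behind the split -/

/-- The per-point remainder of the one-coordinate split is nonnegative: for `0/1` values with `a₀ ≤ a₁`, `a₀' ≤ a₁'`, `b₀ ≤ b₁`,
`c₀ ≤ c₁ ≤ 1`, `0 ≤ c₀' ≤ c₁'`,
`0 ≤ (a₁' − a₀')(1 − a₁)(b₁c₁ − b₀c₀) + [a₀a₀'b₀c₀' + a₁a₁'b₁c₁' − a₀a₁'b₀c₁' − a₁a₀'b₁c₀']`. [this work] -/
theorem split_pointwise_nonneg (a₀ a₁ a₀' a₁' b₀ b₁ c₀ c₁ c₀' c₁' : ℤ)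
    (ha₀ : a₀ = 0 ∨ a₀ = 1) (ha₁ : a₁ = 0 ∨ a₁ = 1) (ha₀' : a₀' = 0 ∨ a₀' = 1) (ha₁' : a₁' = 0 ∨ a₁' = 1)
    (hb₀ : b₀ = 0 ∨ b₀ = 1) (hb₁ : b₁ = 0 ∨ b₁ = 1)
    (hc₀ : 0 ≤ c₀) (hc : c₀ ≤ c₁) (hc₁ : c₁ ≤ 1) (hc₀' : 0 ≤ c₀') (hc' : c₀' ≤ c₁')
    (ha : a₀ ≤ a₁) (ha' : a₀' ≤ a₁') (hb : b₀ ≤ b₁) :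
    0 ≤ (a₁' - a₀') * (1 - a₁) * (b₁ * c₁ - b₀ * c₀)
      + (a₀ * a₀' * b₀ * c₀' + a₁ * a₁' * b₁ * c₁' - a₀ * a₁' * b₀ * c₁' - a₁ * a₀' * b₁ * c₀') := by
  rcases ha₀ with rfl | rfl <;> rcases ha₁ with rfl | rfl <;> rcases ha₀' with rfl | rfl <;> rcases ha₁' with rfl | rfl <;>
    rcases hb₀ with rfl | rfl <;> rcases hb₁ with rfl | rfl <;> omega

/-! ### The one-coordinate split of `threeSetN` -/

section Split

variable {ι : Type*} [DecidableEq ι] [Fintype ι]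

/-- A sum over the subsets of `Unit` has two terms, `∅` and `univ`. [folklore] -/
theorem sum_finset_unit (f : Finset Unit → ℤ) : ∑ q : Finset Unit, f q = f ∅ + f univ := by
  refine Fintype.sum_eq_add ∅ univ (Finset.univ_nonempty.ne_empty).symm fun q hq => ?_
  exfalso
  rcases q.eq_empty_or_nonempty with h | ⟨u, hu⟩
  · exact hq.1 h
  · exact hq.2 (eq_univ_of_forall fun x => by cases x; cases u; exact hu)

omit [Fintype ι] in
/-- Layers of an up-set are nested: `χ_{𝒳₀}(e) ≤ χ_{𝒳₁}(e)`. [this work] -/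
theorem chi_fib_empty_le {𝒳 : Finset (Finset (ι ⊕ Unit))} (h𝒳 : IsUpperSet (𝒳 : Set (Finset (ι ⊕ Unit)))) (e : Finset ι) :
    chi 𝒳 (e.disjSum (∅ : Finset Unit)) ≤ chi 𝒳 (e.disjSum (univ : Finset Unit)) := by
  unfold chi
  by_cases h0 : e.disjSum (∅ : Finset Unit) ∈ 𝒳
  · have h1 : e.disjSum (univ : Finset Unit) ∈ 𝒳 := h𝒳 (disjSum_mono le_rfl (empty_subset _)) h0
    rw [if_pos h0, if_pos h1]
  · rw [if_neg h0]; split_ifs <;> omega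

/-- **The one-coordinate split** (this work).  For up-sets `𝒜, ℬ, 𝒞` of `2^(ι ⊕ Unit)` with layers `𝒳₀ = fib 𝒳 ∅`, `𝒳₁ = fib 𝒳 univ`
and jump set `J = 𝒜₁ ∖ 𝒜₀`:
`threeSetN 𝒜₀ ℬ₀ 𝒞₀ + threeSetN 𝒜₁ ℬ₁ 𝒞₁ ≤ threeSetN 𝒜 ℬ 𝒞 + #(J ∩ Jᶜˢ ∩ ℬ₀ ∩ 𝒞₀)`.  The defect counts the complementary pairs
inside the jump set whose lower member lies in `ℬ₀ ∩ 𝒞₀`; everything else in the difference is a sum of products of nonnegative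
differences (`split_pointwise_nonneg`). [this work] -/
theorem threeSetN_fib_add_fib_le {𝒜 ℬ 𝒞 : Finset (Finset (ι ⊕ Unit))} (h𝒜 : IsUpperSet (𝒜 : Set (Finset (ι ⊕ Unit))))
    (hℬ : IsUpperSet (ℬ : Set (Finset (ι ⊕ Unit)))) (h𝒞 : IsUpperSet (𝒞 : Set (Finset (ι ⊕ Unit)))) :
    threeSetN (fib 𝒜 ∅) (fib ℬ ∅) (fib 𝒞 ∅) + threeSetN (fib 𝒜 univ) (fib ℬ univ) (fib 𝒞 univ)
      ≤ threeSetN 𝒜 ℬ 𝒞 + #((fib 𝒜 univ \ fib 𝒜 ∅) ∩ (fib 𝒜 univ \ fib 𝒜 ∅)ᶜˢ ∩ fib ℬ ∅ ∩ fib 𝒞 ∅) := by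
  -- atoms: layer `j` of `𝒳` at `e`
  set a : Finset Unit → Finset ι → ℤ := fun q e => chi 𝒜 (e.disjSum q) with ha_def
  set b : Finset Unit → Finset ι → ℤ := fun q e => chi ℬ (e.disjSum q) with hb_def
  set c : Finset Unit → Finset ι → ℤ := fun q e => chi 𝒞 (e.disjSum q) with hc_def
  -- the summand of `threeSetN` on the big cube at the point `e ⊎ q` (antipode `eᶜ ⊎ qᶜ`)
  let T : Finset ι → Finset Unit → ℤ := fun e q =>
    a q e * b q e * c q e + a q e * b q e * c q e * a qᶜ eᶜ - a q e * b q e * a qᶜ eᶜ * c qᶜ eᶜ - a q e * b qᶜ eᶜ * c qᶜ eᶜ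
  -- the summand of the layer-`q` functional at `e`
  let L : Finset Unit → Finset ι → ℤ := fun q e =>
    a q e * b q e * c q e + a q e * b q e * c q e * a q eᶜ - a q e * b q e * a q eᶜ * c q eᶜ - a q e * b q eᶜ * c q eᶜ
  -- the defect summand and the two auxiliary quantities
  let d : Finset ι → ℤ := fun e => (a univ e - a ∅ e) * (a univ eᶜ - a ∅ eᶜ) * b ∅ e * c ∅ e
  let X : Finset ι → ℤ := fun e => (a univ eᶜ - a ∅ eᶜ) * (1 - a univ e) * (b univ e * c univ e - b ∅ e * c ∅ e)
    + (a ∅ e * a ∅ eᶜ * b ∅ e * c ∅ eᶜ + a univ e * a univ eᶜ * b univ e * c univ eᶜ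
        - a ∅ e * a univ eᶜ * b ∅ e * c univ eᶜ - a univ e * a ∅ eᶜ * b univ e * c ∅ eᶜ)
  let g : Finset ι → ℤ := fun e => (a univ eᶜ - a ∅ eᶜ) * (b univ e * c univ e - b ∅ e * c ∅ e)
  -- (1) the big functional as a double sum
  have hN : threeSetN 𝒜 ℬ 𝒞 = ∑ e : Finset ι, (T e ∅ + T e univ) := by
    rw [threeSetN_eq_sum, sum_finset_sum_eq]
    refine Finset.sum_congr rfl fun e _ => ?_
    rw [sum_finset_unit]
    simp only [T, compl_disjSum, ha_def, hb_def, hc_def, Finset.compl_empty, Finset.compl_univ]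
  -- (2) the layer functionals
  have hL : ∀ q : Finset Unit, threeSetN (fib 𝒜 q) (fib ℬ q) (fib 𝒞 q) = ∑ e : Finset ι, L q e := by
    intro q
    rw [threeSetN_eq_sum]
    simp only [chi_fib, L, ha_def, hb_def, hc_def]
  -- (3) the defect as a sum
  have hD : (#((fib 𝒜 univ \ fib 𝒜 ∅) ∩ (fib 𝒜 univ \ fib 𝒜 ∅)ᶜˢ ∩ fib ℬ ∅ ∩ fib 𝒞 ∅) : ℤ) = ∑ e : Finset ι, d e := by
    rw [card_eq_sum_chi]
    refine Finset.sum_congr rfl fun e _ => ?_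
    simp only [chi_inter, chi_compls, chi_sdiff, chi_fib, d, ha_def, hb_def, hc_def]
    -- `χ₁ (1 − χ₀) = χ₁ − χ₀` for nested layers
    have h1 := chi_fib_empty_le h𝒜 e
    have h2 := chi_fib_empty_le h𝒜 eᶜ
    rcases chi_zero_or_one 𝒜 (e.disjSum ∅) with p | p <;> rcases chi_zero_or_one 𝒜 (e.disjSum univ) with r | r <;>
      rcases chi_zero_or_one 𝒜 (eᶜ.disjSum ∅) with p' | p' <;> rcases chi_zero_or_one 𝒜 (eᶜ.disjSum univ) with r' | r' <;>
      simp only [p, r, p', r'] at h1 h2 ⊢ <;> first | omega | ring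
  -- (4) the per-point identity (a ring identity) and the rebalancing along `e ↦ eᶜ`
  have key : ∀ e : Finset ι, T e ∅ + T e univ + d e - (L ∅ e + L univ e) = X e + (g eᶜ - g e) := by
    intro e
    simp only [T, L, d, X, g, Finset.compl_empty, Finset.compl_univ, compl_compl]
    ring
  have hg : ∑ e : Finset ι, g eᶜ = ∑ e : Finset ι, g e := sum_comp_compl g
  -- (5) pointwise nonnegativity
  have hX : ∀ e : Finset ι, 0 ≤ X e := by
    intro e
    exact split_pointwise_nonneg (a ∅ e) (a univ e) (a ∅ eᶜ) (a univ eᶜ) (b ∅ e) (b univ e) (c ∅ e) (c univ e)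
      (c ∅ eᶜ) (c univ eᶜ) (chi_zero_or_one _ _) (chi_zero_or_one _ _) (chi_zero_or_one _ _) (chi_zero_or_one _ _)
      (chi_zero_or_one _ _) (chi_zero_or_one _ _) (chi_nonneg _ _) (chi_fib_empty_le h𝒞 e) (chi_le_one _ _)
      (chi_nonneg _ _) (chi_fib_empty_le h𝒞 eᶜ) (chi_fib_empty_le h𝒜 e) (chi_fib_empty_le h𝒜 eᶜ)
      (chi_fib_empty_le hℬ e)
  -- assemble
  rw [hN, hL, hL, hD, ← Finset.sum_add_distrib, ← Finset.sum_add_distrib]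
  have hdiff : ∑ e : Finset ι, (T e ∅ + T e univ + d e) - ∑ e : Finset ι, (L ∅ e + L univ e) = ∑ e : Finset ι, X e := by
    rw [← Finset.sum_sub_distrib, Finset.sum_congr rfl fun e (_ : e ∈ (univ : Finset (Finset ι))) => key e,
      Finset.sum_add_distrib, Finset.sum_sub_distrib, hg, sub_self, add_zero]
  have hpos : 0 ≤ ∑ e : Finset ι, X e := Finset.sum_nonneg fun e _ => hX e
  linarith

/-- **Complement-free jump ⟹ the induction step** (this work).  If the jump set `J = 𝒜₁ ∖ 𝒜₀` of the up-set `𝒜` across the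
distinguished coordinate contains no complementary pair (`J ∩ Jᶜˢ = ∅`), then nonnegativity of `threeSetN` for the two layer triples
implies it for `(𝒜, ℬ, 𝒞)`. [this work] -/
theorem threeSetN_nonneg_of_fib {𝒜 ℬ 𝒞 : Finset (Finset (ι ⊕ Unit))} (h𝒜 : IsUpperSet (𝒜 : Set (Finset (ι ⊕ Unit))))
    (hℬ : IsUpperSet (ℬ : Set (Finset (ι ⊕ Unit)))) (h𝒞 : IsUpperSet (𝒞 : Set (Finset (ι ⊕ Unit))))
    (hJ : (fib 𝒜 univ \ fib 𝒜 ∅) ∩ (fib 𝒜 univ \ fib 𝒜 ∅)ᶜˢ = ∅) (h0 : 0 ≤ threeSetN (fib 𝒜 ∅) (fib ℬ ∅) (fib 𝒞 ∅))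
    (h1 : 0 ≤ threeSetN (fib 𝒜 univ) (fib ℬ univ) (fib 𝒞 univ)) : 0 ≤ threeSetN 𝒜 ℬ 𝒞 := by
  have h := threeSetN_fib_add_fib_le h𝒜 hℬ h𝒞
  rw [hJ, empty_inter, empty_inter, card_empty, Nat.cast_zero, add_zero] at h
  linarith

end Split

/-! ### Symmetric thresholds -/

section Threshold

/-- Membership in the symmetric threshold family `{S ⊆ [n] : t ≤ #S}` (written as a filter; no new definition). [this work] -/
theorem mem_threshold {n t : ℕ} {S : Finset (Fin n)} : S ∈ (univ.filter fun S : Finset (Fin n) => t ≤ #S) ↔ t ≤ #S := by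
  rw [mem_filter]; simp only [mem_univ, true_and]

/-- Threshold families are up-sets. [this work] -/
theorem isUpperSet_threshold (n t : ℕ) :
    IsUpperSet (((univ.filter fun S : Finset (Fin n) => t ≤ #S) : Finset (Finset (Fin n))) : Set (Finset (Fin n))) := by
  intro S S' hSS' hS
  rw [Finset.mem_coe, mem_threshold] at hS ⊢
  exact hS.trans (card_le_card hSS')

/-- Below half, the threshold family is complement-free: if `n < 2t` then no `S` has both `t ≤ #S` and `t ≤ #Sᶜ`. [this work] -/
theorem threshold_inter_compls (n t : ℕ) (h : n < 2 * t) :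
    (univ.filter fun S : Finset (Fin n) => t ≤ #S) ∩ (univ.filter fun S : Finset (Fin n) => t ≤ #S)ᶜˢ = ∅ := by
  refine eq_empty_of_forall_notMem fun S hS => ?_
  rw [mem_inter, mem_compls, mem_threshold, mem_threshold, card_compl, Fintype.card_fin] at hS
  have := card_le_univ S
  rw [Fintype.card_fin] at this
  omega

/-- The layers of the threshold family transported along `Fin (n+1) ≃ Fin n ⊕ Unit` (last coordinate distinguished) are the threshold
families `t − #q` on `n` points. [this work] -/
theorem fib_famMap_threshold (n t : ℕ) (q : Finset Unit) :
    fib (famMap (finSumFinEquiv.symm.trans (Equiv.sumCongr (Equiv.refl (Fin n)) finOneEquiv))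
        (univ.filter fun S : Finset (Fin (n + 1)) => t ≤ #S)) q
      = univ.filter fun S : Finset (Fin n) => t - #q ≤ #S := by
  ext e
  rw [mem_fib, mem_famMap, mem_threshold, mem_threshold, card_map, card_disjSum]
  omega

/-- The jump set of the transported threshold family is `{e : #e + 1 = t}`. [this work] -/
theorem mem_jump_threshold {n t : ℕ} {e : Finset (Fin n)} :
    e ∈ fib (famMap (finSumFinEquiv.symm.trans (Equiv.sumCongr (Equiv.refl (Fin n)) finOneEquiv))
          (univ.filter fun S : Finset (Fin (n + 1)) => t ≤ #S)) univ
        \ fib (famMap (finSumFinEquiv.symm.trans (Equiv.sumCongr (Equiv.refl (Fin n)) finOneEquiv))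
          (univ.filter fun S : Finset (Fin (n + 1)) => t ≤ #S)) ∅ ↔ #e + 1 = t := by
  rw [mem_sdiff, fib_famMap_threshold, fib_famMap_threshold, mem_threshold, mem_threshold, Finset.card_univ,
    Fintype.card_unit, card_empty]
  omega

/-- **`ThreeSetAntipodal` for symmetric thresholds** (this work, unconditional): for every `n, t` and all up-sets `ℬ, 𝒞 ⊆ 2^[n]`,
`0 ≤ threeSetN {S : t ≤ #S} ℬ 𝒞`.  Induction on `n` by the one-coordinate split: the layers are the thresholds `t`, `t − 1` on `n − 1`
points, and the jump set `{#e = t − 1}` is complement-free unless `n = 2t − 1`, in which case (as whenever `n < 2t`) the family itself is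
complement-free and the known face `threeSetN_nonneg_of_inter_compls_eq_empty` applies. [this work] -/
theorem threeSetN_threshold_nonneg : ∀ (n t : ℕ) (ℬ 𝒞 : Finset (Finset (Fin n))), IsUpperSet (ℬ : Set (Finset (Fin n))) →
    IsUpperSet (𝒞 : Set (Finset (Fin n))) → 0 ≤ threeSetN (univ.filter fun S : Finset (Fin n) => t ≤ #S) ℬ 𝒞 := by
  intro n
  induction n with
  | zero =>
    intro t ℬ 𝒞 hℬ h𝒞
    -- on the empty ground set the threshold family is `univ` (`t = 0`) or complement-free (`t ≥ 1`)
    by_cases ht : t = 0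
    · have h0 : (univ.filter fun S : Finset (Fin 0) => t ≤ #S) = univ :=
        eq_univ_of_forall fun S => by rw [mem_threshold, ht]; exact Nat.zero_le _
      rw [h0]; exact threeSetN_nonneg_univ_left hℬ h𝒞
    · exact threeSetN_nonneg_of_inter_compls_eq_empty (isUpperSet_threshold 0 t) hℬ h𝒞
        (threshold_inter_compls 0 t (by omega))
  | succ n ih =>
    intro t ℬ 𝒞 hℬ h𝒞
    by_cases hlt : n + 1 < 2 * t
    · exact threeSetN_nonneg_of_inter_compls_eq_empty (isUpperSet_threshold _ t) hℬ h𝒞 (threshold_inter_compls _ t hlt)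
    · -- split off the last coordinate
      rw [← threeSetN_famMap (finSumFinEquiv.symm.trans (Equiv.sumCongr (Equiv.refl (Fin n)) finOneEquiv))]
      refine threeSetN_nonneg_of_fib (isUpperSet_famMap _ (isUpperSet_threshold _ t)) (isUpperSet_famMap _ hℬ)
        (isUpperSet_famMap _ h𝒞) ?_ ?_ ?_
      · -- the jump set `{#e = t - 1}` contains no complementary pair since `n ≠ 2t - 2`
        refine eq_empty_of_forall_notMem fun x hx => ?_
        rw [mem_inter, mem_compls, mem_jump_threshold, mem_jump_threshold, card_compl, Fintype.card_fin] at hx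
        have := card_le_univ x
        rw [Fintype.card_fin] at this
        omega
      · rw [fib_famMap_threshold]
        exact ih _ _ _ (isUpperSet_fib (isUpperSet_famMap _ hℬ) _) (isUpperSet_fib (isUpperSet_famMap _ h𝒞) _)
      · rw [fib_famMap_threshold]
        exact ih _ _ _ (isUpperSet_fib (isUpperSet_famMap _ hℬ) _) (isUpperSet_fib (isUpperSet_famMap _ h𝒞) _)

/-- Packaged form: `ThreeSetAntipodal` holds whenever `𝒜` is a symmetric threshold up-set `{S : t ≤ #S}` (membership decided by
`#S` through a threshold), for all up-sets `ℬ, 𝒞`. [this work] -/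
theorem threeSetN_nonneg_of_threshold {n t : ℕ} {𝒜 ℬ 𝒞 : Finset (Finset (Fin n))} (h𝒜 : ∀ S, S ∈ 𝒜 ↔ t ≤ #S)
    (hℬ : IsUpperSet (ℬ : Set (Finset (Fin n)))) (h𝒞 : IsUpperSet (𝒞 : Set (Finset (Fin n)))) : 0 ≤ threeSetN 𝒜 ℬ 𝒞 := by
  have h : 𝒜 = univ.filter fun S : Finset (Fin n) => t ≤ #S := by
    ext S; rw [h𝒜 S, mem_threshold]
  rw [h]; exact threeSetN_threshold_nonneg n t ℬ 𝒞 hℬ h𝒞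

end Threshold

end Summit.CriticalPhenomena.PercolationContinuityZ3.Theorems.TwoPartition
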